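import Summits.QuantumFields.QCD.Theses.SpectralDefectExtinction
import Summits.QuantumFields.QCD.Theorems.ExtinctionBuildsQCD.Negative.ExtinctIntegrable
import Summits.QuantumFields.QCD.Theorems.SpectralDefectExtinctionWindowExtinctionCornerFlatMassOnResonantAux
import Literature.MathematicalPhysics.QuantumLattice.WilsonHopFlatSections

/-!
# Line `corner-decorrelation-deep-hole`, stub S2a: flat mass on resonant plaquettes

Crux `WindowExtinction` (stmt-QuantumFields-18063, route `SpectralDefectExtinction`), registered stub
`stub_flatMassOnResonant` of the skeleton `Cruxes/WindowExtinction/Lines/corner_decorrelation_deep_hole.lean`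
(the deterministic heart of the two-line decay S2).

For every gauge field `U` on a torus `(ℤ/L)⁴`, every `θ > 0` and every fermion field `ψ` that is
`θ`-flat for the Wilson hopping operator `K_U = Σ_μ W_μ` (`|⟨ψ, K_Uψ⟩| ≥ 4(1−θ)‖ψ‖²`):

1. (phase) the four isometries `W_μ` share a near-eigenphase `u`, `‖W_μψ − uψ‖² ≤ 8θ‖ψ‖²`
   (`cornerFlat_phase`, from `Literature.Analysis.InnerProduct.norm_sub_phase_smul_sq_le_of_sum_inner`);
2. (flat section) by the exact identity `sum_norm_sq_wilsonHop_mulVec_sub_smul` this is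
   `Σ_y ‖D_μ(y)‖_F² ≤ 8θ‖ψ‖²` for the site defects `D_μ(y) = Ψ(y) − ρ(U(y,μ)) Ψ(y+μ̂) T_μ` with the unitary
   spin twist `T_μ = (ūP⁻_μ + uP⁺_μ)ᵀ` (`cornerFlat_twist_mem_unitaryGroup`);
3. (Kato) `|‖Ψ(y)‖ − ‖Ψ(y+μ̂)‖| ≤ ‖D_μ(y)‖_F`, whence the Dirichlet energy bound `≤ 32θ‖ψ‖²`;
4.–5. (telescoping + coercivity, `cornerFlat_site_bound`) around the plaquette `P₀₁(y)` the holonomy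
   defect of `Φ = Ψ(y+0̂+1̂)` is at most the four link defects, and the unitary `Φ ↦ ρ(U_P)ΦR`
   (`R = (T₀T₁)ᴴT₁T₀`) is `ε`-coercive unless a characteristic root of `ρ(U_P)` is within `ε = √(512θ)` of
   a conjugate characteristic root of `R`; so the non-resonant sites carry mass `≤ 4·32θ/ε² = 1/4`;
6. (grid) each of the four conjugate roots `e^{iφ_a}` of `R` is rounded to `k_a = round(φ_a/ε)`
   (`cornerFlat_round_phase`): resonant sites have a root of `ρ(U_P)` within `3ε/2 ≤ √(2048θ)` of
   `e^{ik_aε}`, `|k_a| ≤ π/ε + 1`.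
-/

noncomputable section

namespace Summit.QuantumFields.QCD.Cruxes.WindowExtinction.CornerDecorrelationDeepHole

open scoped BigOperators Topology Classical Matrix ComplexConjugate
open Filter MeasureTheory
open Literature.MathematicalPhysics.QuantumLattice Literature.MathematicalPhysics.QuantumFieldTheory
  Literature.Probability.LatticeModels Literature.Analysis.InnerProduct

/-- **S2a · FLAT MASS ON RESONANT PLAQUETTES (deterministic).**  For every gauge field `U` on any
torus, every `θ > 0` and every fermion field `ψ` with `|⟨ψ, K_U ψ⟩| ≥ 4(1−θ)‖ψ‖²`, `K_U = Σ_μ W_μ`: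
(i) KATO — the site norm `f(y) = ‖ψ(y,·,·)‖` has `Σ_{y,μ} (f(y) − f(y+μ̂))² ≤ 32θ‖ψ‖²`;
(ii) RESONANT MASS — there are four grid integers `k_a`, `|k_a| ≤ π/√(512θ) + 1`, such that `≥ 3/4`
of `Σ_y ‖ψ(y+0̂+1̂)‖²` sits on the sites `y` whose plaquette `ρ(U_{P_{01}(y)})` has a characteristic
root within `√(2048θ)` of some `e^{i k_a √(512θ)}`.
Proof: phase alignment `‖W_μψ − uψ‖² ≤ 8θ‖ψ‖²` (`cornerFlat_phase`); the exact identity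
`sum_norm_sq_wilsonHop_mulVec_sub_smul` turns this into site defects
`D_μ(y) = Ψ(y) − ρ(U(y,μ))Ψ(y+μ̂)T_μ`, `T_μ = (ūP⁻_μ + uP⁺_μ)ᵀ` unitary, `Σ_y‖D_μ(y)‖_F² ≤ 8θ‖ψ‖²`;
Kato by the reverse triangle inequality; around `P_{01}(y)` the site bound `cornerFlat_site_bound`
(telescoping + coercivity of the unitary `ρ(U_P) ⊗ Rᵀ` off resonance, `R = (T₀T₁)ᴴT₁T₀`,
`ε = √(512θ)`) gives non-resonant mass `≤ 4 · 32θ/ε² = 1/4`; finally each conjugate root `e^{iφ_a}` of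
`R` is rounded to the grid, `k_a = round(φ_a/ε)`, `‖σ − e^{ik_aε}‖ ≤ 3ε/2 ≤ √(2048θ)`. -/
theorem stub_flatMassOnResonant :
    ∀ (L : ℕ) [NeZero L] (U : GaugeConfig 4 L SU3) (θ : ℝ) (ψ : QuarkIdx L → ℂ), 0 < θ →
    4 * (1 - θ) * (∑ p, ‖ψ p‖ ^ 2) ≤
    ‖∑ p, star (ψ p) * ((∑ μ, wilsonHop (fundamentalRep (Fin 3)) U μ) *ᵥ ψ) p‖ →
    (∑ y : TorusSite 4 L, ∑ μ : Fin 4,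
    (Real.sqrt (∑ a, ∑ s, ‖ψ (y, a, s)‖ ^ 2) - Real.sqrt (∑ a, ∑ s, ‖ψ (y + Pi.single μ 1, a, s)‖ ^ 2)) ^ 2) ≤
    32 * θ * ∑ p, ‖ψ p‖ ^ 2 ∧
    ∃ k : Fin 4 → ℤ, (∀ i, (|k i| : ℝ) ≤ Real.pi / Real.sqrt (512 * θ) + 1) ∧
    3 / 4 * (∑ p, ‖ψ p‖ ^ 2) ≤
    ∑ y ∈ (Finset.univ : Finset (TorusSite 4 L)).filter (fun y => ∃ i : Fin 4,
    1 ≤ Multiset.countP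
    (fun w : ℂ => ‖w - Complex.exp (↑((k i : ℝ) * Real.sqrt (512 * θ)) * Complex.I)‖ ≤ Real.sqrt (2048 * θ))
    (fundamentalRep (Fin 3) (plaquetteHolonomy U y 0 1)).charpoly.roots),
    ∑ a, ∑ s, ‖ψ (y + Pi.single 0 1 + Pi.single 1 1, a, s)‖ ^ 2 := by
  intro L _ U θ ψ hθ hflat
  -- the representation and the total mass
  set ρ : SU3 →* Matrix (Fin 3) (Fin 3) ℂ := fundamentalRep (Fin 3) with hρdef
  have hρ : ∀ g, ρ g ∈ Matrix.unitaryGroup (Fin 3) ℂ := fundamentalRep_mem_unitaryGroup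
  set S : ℝ := ∑ p, ‖ψ p‖ ^ 2 with hS
  -- STEP 1: a common near-eigenphase `u` of the four hopping matrices
  obtain ⟨u, hu, hdef⟩ := cornerFlat_phase ρ hρ U θ ψ hflat
  -- STEP 2: flat sections — the unitary spin twists `T μ`, the site matrices `Ψ x`, the defects `d μ x`
  set T : Fin 4 → Matrix (Fin 4) (Fin 4) ℂ := fun μ =>
    (conj u • chiralProjMinus μ + u • chiralProjPlus μ)ᵀ with hTdef
  have hT : ∀ μ, T μ ∈ Matrix.unitaryGroup (Fin 4) ℂ := fun μ => cornerFlat_twist_mem_unitaryGroup hu μ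
  set Ψ : TorusSite 4 L → Matrix (Fin 3) (Fin 4) ℂ := fun x => Matrix.of fun b t => ψ (x, b, t)
    with hΨdef
  set d : Fin 4 → TorusSite 4 L → ℝ := fun μ x =>
    ∑ a, ∑ s, ‖(Ψ x - ρ (U (x, μ)) * Ψ (Site.shift x μ) * T μ) a s‖ ^ 2 with hddef
  have hE : ∀ μ, ∑ x, d μ x ≤ 8 * θ * S := fun μ => by
    have h := hdef μ
    rw [sum_norm_sq_wilsonHop_mulVec_sub_smul ρ hρ U μ ψ hu] at h
    exact h
  have hd0 : ∀ μ x, 0 ≤ d μ x := fun μ x =>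
    Finset.sum_nonneg fun _ _ => Finset.sum_nonneg fun _ _ => by positivity
  have hρU : ∀ e, (ρ (U e))ᴴ * ρ (U e) = 1 := fun e => Matrix.mem_unitaryGroup_iff'.mp (hρ _)
  have hTT : ∀ μ, T μ * (T μ)ᴴ = 1 := fun μ => Matrix.mem_unitaryGroup_iff.mp (hT μ)
  refine ⟨?_, ?_⟩
  · -- STEP 3 (i): KATO
    calc ∑ y : TorusSite 4 L, ∑ μ : Fin 4, (Real.sqrt (∑ a, ∑ s, ‖ψ (y, a, s)‖ ^ 2) -
            Real.sqrt (∑ a, ∑ s, ‖ψ (y + Pi.single μ 1, a, s)‖ ^ 2)) ^ 2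
          = ∑ μ : Fin 4, ∑ y : TorusSite 4 L, (Real.sqrt (∑ a, ∑ s, ‖ψ (y, a, s)‖ ^ 2) -
            Real.sqrt (∑ a, ∑ s, ‖ψ (y + Pi.single μ 1, a, s)‖ ^ 2)) ^ 2 := Finset.sum_comm
      _ ≤ ∑ μ : Fin 4, ∑ y : TorusSite 4 L, d μ y := by
          refine Finset.sum_le_sum fun μ _ => Finset.sum_le_sum fun y _ => ?_
          have e2 : ∑ a, ∑ s, ‖ψ (y + Pi.single μ 1, a, s)‖ ^ 2 =
              ∑ a, ∑ s, ‖(ρ (U (y, μ)) * Ψ (Site.shift y μ) * T μ) a s‖ ^ 2 := by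
            rw [cornerFlat_sum_norm_sq_unitary_mul (hρU (y, μ)) (hTT μ)]
            rfl
          rw [e2]
          exact cornerFlat_sqrt_sub_sqrt_sq_le (Ψ y) _
      _ ≤ ∑ _μ : Fin 4, 8 * θ * S := Finset.sum_le_sum fun μ _ => hE μ
      _ = 32 * θ * S := by
          rw [Finset.sum_const, Finset.card_univ, Fintype.card_fin, nsmul_eq_mul]
          push_cast
          ring
  · -- STEP 4–6 (ii): RESONANT MASS
    set ε : ℝ := Real.sqrt (512 * θ) with hεdef
    have hε : 0 < ε := Real.sqrt_pos.mpr (by positivity)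
    have hε2 : ε ^ 2 = 512 * θ := Real.sq_sqrt (by positivity)
    have h2ε : 2 * ε ≤ Real.sqrt (2048 * θ) :=
      Real.le_sqrt_of_sq_le (by nlinarith [hε2])
    -- the holonomy twist `R = (T₀T₁)ᴴ T₁T₀ ∈ U(4)` and an enumeration of its characteristic roots
    set R : Matrix (Fin 4) (Fin 4) ℂ := (T 0 * T 1)ᴴ * (T 1 * T 0) with hRdef
    have hR : R ∈ Matrix.unitaryGroup (Fin 4) ℂ :=
      mul_mem (Unitary.star_mem (mul_mem (hT 0) (hT 1))) (mul_mem (hT 1) (hT 0))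
    obtain ⟨r, hr, hrsurj⟩ := cornerFlat_exists_roots_enum R
    have hr1 : ∀ i, ‖conj (r i)‖ = 1 := fun i => by
      rw [Complex.norm_conj]
      exact norm_eq_one_of_mem_roots_charpoly_of_mem_unitaryGroup hR (hr i)
    -- STEP 6: the grid phases `k_a = round(arg(conj r_a)/ε)`
    refine ⟨fun i => round (Complex.arg (conj (r i)) / ε),
      fun i => (cornerFlat_round_phase (hr1 i) hε).1, ?_⟩
    -- notation for the shifted mass and the resonance predicate
    set e0 : TorusSite 4 L := Pi.single 0 1 with he0
    set e1 : TorusSite 4 L := Pi.single 1 1 with he1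
    set m : TorusSite 4 L → ℝ := fun y => ∑ a, ∑ s, ‖ψ (y + e0 + e1, a, s)‖ ^ 2 with hmdef
    have hm0 : ∀ y, 0 ≤ m y := fun y => Finset.sum_nonneg fun _ _ => Finset.sum_nonneg fun _ _ => by positivity
    set res : TorusSite 4 L → Prop := fun y =>
      ∃ σ ∈ (ρ (plaquetteHolonomy U y 0 1)).charpoly.roots, ∃ i : Fin 4, ‖σ - conj (r i)‖ ≤ ε with hresdef
    -- STEP 4–5: the site bound (telescoping around `P₀₁(y)` + coercivity off resonance)
    have hsite : ∀ y, ε ^ 2 * m y ≤ 4 * (d 0 y + d 1 (y + e0) + d 1 y + d 0 (y + e1)) +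
        (if res y then ε ^ 2 * m y else 0) := by
      intro y
      have hnn : 0 ≤ d 0 y + d 1 (y + e0) + d 1 y + d 0 (y + e1) := by
        have := hd0 0 y; have := hd0 1 (y + e0); have := hd0 1 y; have := hd0 0 (y + e1)
        positivity
      by_cases hy : res y
      · rw [if_pos hy]
        linarith
      · rw [if_neg hy, add_zero]
        have hres' : ∀ σ ∈ (ρ (plaquetteHolonomy U y 0 1)).charpoly.roots, ∀ r' ∈ R.charpoly.roots,
            ε < ‖σ - conj r'‖ := by
          intro σ hσ r' hr'
          by_contra hcon
          obtain ⟨i, hi⟩ := hrsurj r' hr'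
          exact hy ⟨σ, hσ, i, by rw [hi]; exact not_lt.mp hcon⟩
        have hplaq : ρ (plaquetteHolonomy U y 0 1) * ρ (U (y, 1)) * ρ (U (Site.shift y 1, 0)) =
            ρ (U (y, 0)) * ρ (U (Site.shift y 0, 1)) := by
          rw [← map_mul, ← map_mul, cornerFlat_plaquette_mul, map_mul]
        have key := cornerFlat_site_bound (hρ (plaquetteHolonomy U y 0 1)) (hρ (U (y, 0))) (hρ (U (y, 1)))
          (hρ (U (Site.shift y 1, 0))) (hT 0) (hT 1) hplaq (Ψ y) (Ψ (y + e0)) (Ψ (y + e1)) (Ψ (y + e0 + e1))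
          hε.le hres'
        have e4 : (∑ i, ∑ j, ‖(Ψ (y + e1) - ρ (U (Site.shift y 1, 0)) * Ψ (y + e0 + e1) * T 0) i j‖ ^ 2) =
            d 0 (y + e1) := by
          rw [add_right_comm y e0 e1]
          rfl
        calc ε ^ 2 * m y = ε ^ 2 * ∑ i, ∑ j, ‖Ψ (y + e0 + e1) i j‖ ^ 2 := rfl
          _ ≤ _ := key
          _ = 4 * (d 0 y + d 1 (y + e0) + d 1 y + d 0 (y + e1)) := by rw [e4]; rfl
    -- sum the site bound over the torus
    have hshift : ∀ (F : TorusSite 4 L → ℝ) (e : TorusSite 4 L), ∑ y, F (y + e) = ∑ y, F y := fun F e =>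
      Fintype.sum_equiv (Equiv.addRight e) _ _ fun _ => rfl
    have hmS : ∑ y, m y = S := by
      have h1 : ∑ y, m y = ∑ y, (fun z => ∑ a, ∑ s, ‖ψ (z, a, s)‖ ^ 2) (y + (e0 + e1)) :=
        Finset.sum_congr rfl fun y _ => by simp only [hmdef, add_assoc]
      rw [h1, hshift (fun z => ∑ a, ∑ s, ‖ψ (z, a, s)‖ ^ 2) (e0 + e1), hS, Fintype.sum_prod_type]
      exact Finset.sum_congr rfl fun y _ =>
        (Fintype.sum_prod_type (fun q : Fin 3 × Fin 4 => ‖ψ (y, q)‖ ^ 2)).symm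
    have hsum := Finset.sum_le_sum fun y (_ : y ∈ (Finset.univ : Finset (TorusSite 4 L))) => hsite y
    simp only [Finset.sum_add_distrib, ← Finset.mul_sum] at hsum
    rw [hmS, hshift (d 1) e0, hshift (d 0) e1, ← Finset.sum_filter, ← Finset.mul_sum, hε2] at hsum
    have hfin : 3 / 4 * S ≤ ∑ y ∈ Finset.univ.filter res, m y := by
      have hE0 := hE 0
      have hE1 := hE 1
      have h : θ * (384 * S) ≤ θ * (512 * ∑ y ∈ Finset.univ.filter res, m y) := by linarith
      have := le_of_mul_le_mul_left h hθ
      linarith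
    refine hfin.trans (Finset.sum_le_sum_of_subset_of_nonneg ?_ fun y _ _ => hm0 y)
    intro y hy
    simp only [Finset.mem_filter, Finset.mem_univ, true_and] at hy ⊢
    obtain ⟨σ, hσ, i, hi⟩ := hy
    refine ⟨i, Nat.succ_le_of_lt (Multiset.countP_pos.mpr ⟨σ, hσ, ?_⟩)⟩
    have hround := (cornerFlat_round_phase (hr1 i) hε).2
    calc ‖σ - Complex.exp (↑((round (Complex.arg (conj (r i)) / ε) : ℝ) * ε) * Complex.I)‖
          ≤ ‖σ - conj (r i)‖ +
            ‖conj (r i) - Complex.exp (↑((round (Complex.arg (conj (r i)) / ε) : ℝ) * ε) * Complex.I)‖ :=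
          norm_sub_le_norm_sub_add_norm_sub _ _ _
      _ ≤ ε + ε / 2 := add_le_add hi hround
      _ ≤ Real.sqrt (2048 * θ) := by linarith

end Summit.QuantumFields.QCD.Cruxes.WindowExtinction.CornerDecorrelationDeepHole

end
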